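import Mathlib
import Summits.CriticalPhenomena.PercolationContinuityZ3.Theorems.PercNearOneGluingNoHeavyLowerTailStairKernels
import Summits.CriticalPhenomena.PercolationContinuityZ3.Theorems.PercNearOneGluingNoHeavyLowerTailHurwitzPairPivots
import Summits.CriticalPhenomena.PercolationContinuityZ3.Theorems.PercNearOneGluingNoHeavyLowerTailTwoNeutralClassicalPivots
import HarnessLib

/-!
# CONJECTURE R at the vertex (1,1,0): two neutral copies and one classical copy

Support file for the Sahi / Conjecture-P programme of route `PercNearOneGluingNoHeavy`
(`--supports stmt-CriticalPhenomena-4575`, prover prim-l12-p5 gen 51/52; proof note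
`prim-l12-p5/PROOF-VERTEX-110-g51.md`).  No definitions, no named facts, no sorries.

Companion of `…NeutralTwoClassicalHurwitzTN` (vertex `(1,0,0)`) and `…TwoNeutralClassicalPivots` (the pivot
inequalities `g6_pos`, `g8_pos`, `g9_pos`, `g10_pos` used below).  With `…NeutralHurwitzRTN` (all-neutral
vertices), `…ClassicalVertexHurwitzTN` (all-classical vertex) and `…TwoFactorHurwitzTN`/`…NeutralClassicalHurwitzTN`
(`T = 2`), this settles CONJECTURE R at every vertex of the idle-ratio cube `{0,1}^3` with the classical copies
last (`twoNeutralClassical_hurwitz_tn`).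
-/

namespace Summit.CriticalPhenomena.PercolationContinuityZ3.Theorems

namespace TwoNeutralClassical

open Finset Matrix

set_option maxHeartbeats 1000000 in -- polynomial identity behind the stage-4 closed form (`ring`)
set_option maxRecDepth 4000 in
/-- Stage-4 identity `G₅(k)·G₈(k) - (k+r)·G₆(k)·G₇(k) = G₃·G₉(k)`. -/
theorem stage4_id (b₁ b₂ β r k : ℝ) :
    ((2 * k + r + 1) * b₁ ^ 2 * b₂ + (r + 2) * (2 * k + r + 1) * b₁ ^ 2 * β + (2 * k + r + 1) * b₁ * b₂ ^ 2 - 2 * (r - 1) * (2 * k + 3 * r + 3) * b₁ * b₂ * β + (r + 2) * (k + r + 1) * (3 * k + r + 2) * b₁ * β ^ 2 + (r + 2) * (2 * k + r + 1) * b₂ ^ 2 * β + (r + 2) * (k + r + 1) * (3 * k + r + 2) * b₂ * β ^ 2) * ((r + 1) * b₁ ^ 3 * b₂ ^ 2 - 2 * (r + 1) * (k + r - 1) * b₁ ^ 3 * b₂ * β + (k + r) * (r + 2) * (k + r - 1) * b₁ ^ 3 * β ^ 2 + (r + 1) * b₁ ^ 2 * b₂ ^ 3 + 2 * (r + 1)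 * b₁ ^ 2 * b₂ ^ 2 * β + (k + r) * (r + 2) ^ 2 * (k + r - 1) * b₁ ^ 2 * β ^ 3 - 2 * (r + 1) * (k + r - 1) * b₁ * b₂ ^ 3 * β - 2 * (k + r) * (r + 2) ^ 2 * (k + r - 1) * b₁ * b₂ * β ^ 3 + (k + r) * (r + 2) * (k + r - 1) * b₂ ^ 3 * β ^ 2 + (k + r) * (r + 2) ^ 2 * (k + r - 1) * b₂ ^ 2 * β ^ 3) - (k + r) * (2 * b₁ ^ 2 * b₂ ^ 2 - 2 * (r - 1) * b₁ ^ 2 * b₂ * β + (r + 2) * (3 * k + 2 * r + 1) * b₁ ^ 2 * β ^ 2 - 2 * (r - 1) * b₁ * b₂ ^ 2 * β - 2 * (r - 1) * (r + 2) * b₁ * b₂ * β ^ 2 + (r + 2) * (3 * k + 2 * r + 1) * b₂ ^ 2 * β ^ 2) * (2 * (r + 1) * b₁ ^ 2 * b₂ ^ 2 - 2 * (r + 1) * (k + r - 1) * b₁ ^ 2 * b₂ * β + (r + 2) * (k + r - 1) * (k + 2 * r + 2) * b₁ ^ 2 * β ^ 2 - 2 * (r + 1) * (k + r - 1) * b₁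 * b₂ ^ 2 * β - 2 * (r + 1) * (r + 2) * (k + r - 1) * b₁ * b₂ * β ^ 2 + (r + 2) * (k + r - 1) * (k + 2 * r + 2) * b₂ ^ 2 * β ^ 2) = (b₁ * b₂ + β * (r + 2) * (b₁ + b₂)) * ((r + 1) * (2 * k + r + 1) * b₁ ^ 4 * b₂ ^ 2 - 2 * (r + 1) * (k + r - 1) * (2 * k + r + 1) * b₁ ^ 4 * b₂ * β + (k + r) * (r + 2) * (k + r - 1) * (2 * k + r + 1) * b₁ ^ 4 * β ^ 2 - 2 * (r - 1) * (r + 1) * b₁ ^ 3 * b₂ ^ 3 + 2 * (r + 1) * (k * r + k + r ^ 2 - 2 * r + 3) * b₁ ^ 3 * b₂ ^ 2 * β + 2 * (r + 1) * (k + r - 1) * (k * r - 4 * k + r ^ 2 - 2 * r - 2) * b₁ ^ 3 * b₂ * β ^ 2 - 2 * (k + r) * (r - 1) * (r + 2) * (k + r - 1) * (k + r + 1) * b₁ ^ 3 * β ^ 3 + (r + 1) * (2 * k + r + 1) * b₁ ^ 2 * b₂ ^ 4 + 2 * (r + 1) * (k * r + k + r ^ 2 - 2 * r + 3) * b₁ ^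 2 * b₂ ^ 3 * β - 2 * (r + 1) * (3 * k ^ 2 * r - 6 * k ^ 2 + 6 * k * r ^ 2 - 13 * k * r - 2 * k + 3 * r ^ 3 - 7 * r ^ 2 - 2) * b₁ ^ 2 * b₂ ^ 2 * β ^ 2 + 2 * (k + r) * (r - 1) * (r + 2) * (k + r - 1) * (k + r + 1) * b₁ ^ 2 * b₂ * β ^ 3 + (k + r) * (r + 2) ^ 2 * (k + r - 1) * (k + r + 1) * (3 * k + r + 2) * b₁ ^ 2 * β ^ 4 - 2 * (r + 1) * (k + r - 1) * (2 * k + r + 1) * b₁ * b₂ ^ 4 * β + 2 * (r + 1) * (k + r - 1) * (k * r - 4 * k + r ^ 2 - 2 * r - 2) * b₁ * b₂ ^ 3 * β ^ 2 + 2 * (k + r) * (r - 1) * (r + 2) * (k + r - 1) * (k + r + 1) * b₁ * b₂ ^ 2 * β ^ 3 - 2 * (k + r) * (r + 2) ^ 2 * (k + r - 1) * (k + r + 1) * (3 * k + r + 2) * b₁ * b₂ * β ^ 4 + (k + r) * (r + 2) * (k + r - 1) * (2 * k + r + 1) * b₂ ^ 4 * β ^ 2 - 2 * (k + r) * (r -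 1) * (r + 2) * (k + r - 1) * (k + r + 1) * b₂ ^ 3 * β ^ 3 + (k + r) * (r + 2) ^ 2 * (k + r - 1) * (k + r + 1) * (3 * k + r + 2) * b₂ ^ 2 * β ^ 4) := by
  ring

set_option maxHeartbeats 4000000 in -- reflective commutative-ring normalisation (`grind`)
set_option maxRecDepth 8000 in
/-- Stage-5 identity `G₇(k+1)·G₉(k) - 2(k+1)·G₈(k)·G₈(k+1) = (k+r)·G₆(k)·G₁₀(k+1)` (35×242 + 60×60 + 18×216 monomial products: out of reach of `ring`, proved by the reflective ring normaliser of `grind`). -/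
theorem stage5_id (b₁ b₂ β r k : ℝ) :
    (2 * (r + 1) * b₁ ^ 2 * b₂ ^ 2 - 2 * (r + 1) * ((k + 1) + r - 1) * b₁ ^ 2 * b₂ * β + (r + 2) * ((k + 1) + r - 1) * ((k + 1) + 2 * r + 2) * b₁ ^ 2 * β ^ 2 - 2 * (r + 1) * ((k + 1) + r - 1) * b₁ * b₂ ^ 2 * β - 2 * (r + 1) * (r + 2) * ((k + 1) + r - 1) * b₁ * b₂ * β ^ 2 + (r + 2) * ((k + 1) + r - 1) * ((k + 1) + 2 * r + 2) * b₂ ^ 2 * β ^ 2) * ((r + 1) * (2 * k + r + 1) * b₁ ^ 4 * b₂ ^ 2 - 2 * (r + 1) * (k + r - 1) * (2 * k + r + 1) * b₁ ^ 4 * b₂ * β + (k + r) * (r + 2) * (k + r - 1) * (2 * k + r + 1) * b₁ ^ 4 * β ^ 2 - 2 * (r - 1) * (r + 1) * b₁ ^ 3 * b₂ ^ 3 + 2 * (r + 1) * (k * r + k + r ^ 2 - 2 * r + 3) * b₁ ^ 3 * b₂ ^ 2 * β + 2 * (r + 1) * (k + r - 1) * (k * r - 4 * k + r ^ 2 - 2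 * r - 2) * b₁ ^ 3 * b₂ * β ^ 2 - 2 * (k + r) * (r - 1) * (r + 2) * (k + r - 1) * (k + r + 1) * b₁ ^ 3 * β ^ 3 + (r + 1) * (2 * k + r + 1) * b₁ ^ 2 * b₂ ^ 4 + 2 * (r + 1) * (k * r + k + r ^ 2 - 2 * r + 3) * b₁ ^ 2 * b₂ ^ 3 * β - 2 * (r + 1) * (3 * k ^ 2 * r - 6 * k ^ 2 + 6 * k * r ^ 2 - 13 * k * r - 2 * k + 3 * r ^ 3 - 7 * r ^ 2 - 2) * b₁ ^ 2 * b₂ ^ 2 * β ^ 2 + 2 * (k + r) * (r - 1) * (r + 2) * (k + r - 1) * (k + r + 1) * b₁ ^ 2 * b₂ * β ^ 3 + (k + r) * (r + 2) ^ 2 * (k + r - 1) * (k + r + 1) * (3 * k + r + 2) * b₁ ^ 2 * β ^ 4 - 2 * (r + 1) * (k + r - 1) * (2 * k + r + 1) * b₁ * b₂ ^ 4 * β + 2 * (r + 1) * (k + r - 1) * (k * r - 4 * k + r ^ 2 - 2 * r - 2) * b₁ * b₂ ^ 3 * β ^ 2 + 2 * (k + r) * (r - 1) * (r + 2) * (k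 + r - 1) * (k + r + 1) * b₁ * b₂ ^ 2 * β ^ 3 - 2 * (k + r) * (r + 2) ^ 2 * (k + r - 1) * (k + r + 1) * (3 * k + r + 2) * b₁ * b₂ * β ^ 4 + (k + r) * (r + 2) * (k + r - 1) * (2 * k + r + 1) * b₂ ^ 4 * β ^ 2 - 2 * (k + r) * (r - 1) * (r + 2) * (k + r - 1) * (k + r + 1) * b₂ ^ 3 * β ^ 3 + (k + r) * (r + 2) ^ 2 * (k + r - 1) * (k + r + 1) * (3 * k + r + 2) * b₂ ^ 2 * β ^ 4) - 2 * (k + 1) * ((r + 1) * b₁ ^ 3 * b₂ ^ 2 - 2 * (r + 1) * (k + r - 1) * b₁ ^ 3 * b₂ * β + (k + r) * (r + 2) * (k + r - 1) * b₁ ^ 3 * β ^ 2 + (r + 1) * b₁ ^ 2 * b₂ ^ 3 + 2 * (r + 1) * b₁ ^ 2 * b₂ ^ 2 * β + (k + r) * (r + 2) ^ 2 * (k + r - 1) * b₁ ^ 2 * β ^ 3 - 2 * (r + 1) * (k + r - 1) * b₁ * b₂ ^ 3 * β - 2 * (k + r) * (r + 2) ^ 2 * (k + r - 1) * b₁ *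 b₂ * β ^ 3 + (k + r) * (r + 2) * (k + r - 1) * b₂ ^ 3 * β ^ 2 + (k + r) * (r + 2) ^ 2 * (k + r - 1) * b₂ ^ 2 * β ^ 3) * ((r + 1) * b₁ ^ 3 * b₂ ^ 2 - 2 * (r + 1) * ((k + 1) + r - 1) * b₁ ^ 3 * b₂ * β + ((k + 1) + r) * (r + 2) * ((k + 1) + r - 1) * b₁ ^ 3 * β ^ 2 + (r + 1) * b₁ ^ 2 * b₂ ^ 3 + 2 * (r + 1) * b₁ ^ 2 * b₂ ^ 2 * β + ((k + 1) + r) * (r + 2) ^ 2 * ((k + 1) + r - 1) * b₁ ^ 2 * β ^ 3 - 2 * (r + 1) * ((k + 1) + r - 1) * b₁ * b₂ ^ 3 * β - 2 * ((k + 1) + r) * (r + 2) ^ 2 * ((k + 1) + r - 1) * b₁ * b₂ * β ^ 3 + ((k + 1) + r) * (r + 2) * ((k + 1) + r - 1) * b₂ ^ 3 * β ^ 2 + ((k + 1) + r) * (r + 2) ^ 2 * ((k + 1) + r - 1) * b₂ ^ 2 * β ^ 3)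
      = (k + r) * (2 * b₁ ^ 2 * b₂ ^ 2 - 2 * (r - 1) * b₁ ^ 2 * b₂ * β + (r + 2) * (3 * k + 2 * r + 1) * b₁ ^ 2 * β ^ 2 - 2 * (r - 1) * b₁ * b₂ ^ 2 * β - 2 * (r - 1) * (r + 2) * b₁ * b₂ * β ^ 2 + (r + 2) * (3 * k + 2 * r + 1) * b₂ ^ 2 * β ^ 2) * ((r + 1) ^ 2 * b₁ ^ 4 * b₂ ^ 2 - 2 * (r + 1) ^ 2 * ((k + 1) + r - 2) * b₁ ^ 4 * b₂ * β + (r + 1) * (r + 2) * ((k + 1) + r - 2) * ((k + 1) + r - 1) * b₁ ^ 4 * β ^ 2 - 2 * (r + 1) ^ 2 * b₁ ^ 3 * b₂ ^ 3 + 2 * (r + 1) ^ 2 * ((k + 1) + r - 2) * b₁ ^ 3 * b₂ ^ 2 * β + 2 * (r + 1) * ((k + 1) + r - 2) * ((k + 1) * r + r ^ 2 - r - 2) * b₁ ^ 3 * b₂ * β ^ 2 - 2 * ((k + 1) + r) * (r + 1) * (r + 2) * ((k + 1) + r - 2) * ((k + 1) + r - 1) * b₁ ^ 3 * β ^ 3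 + (r + 1) ^ 2 * b₁ ^ 2 * b₂ ^ 4 + 2 * (r + 1) ^ 2 * ((k + 1) + r - 2) * b₁ ^ 2 * b₂ ^ 3 * β - 2 * (r + 1) * (3 * (k + 1) ^ 2 * r + 2 * (k + 1) ^ 2 + 6 * (k + 1) * r ^ 2 - 5 * (k + 1) * r - 10 * (k + 1) + 3 * r ^ 3 - 7 * r ^ 2 - 4 * r + 6) * b₁ ^ 2 * b₂ ^ 2 * β ^ 2 + 2 * ((k + 1) + r) * (r + 1) * (r + 2) * ((k + 1) + r - 2) * ((k + 1) + r - 1) * b₁ ^ 2 * b₂ * β ^ 3 + ((k + 1) + r) * (r + 2) ^ 2 * ((k + 1) + r - 2) * ((k + 1) + r - 1) * ((k + 1) + r + 1) * b₁ ^ 2 * β ^ 4 - 2 * (r + 1) ^ 2 * ((k + 1) + r - 2) * b₁ * b₂ ^ 4 * β + 2 * (r + 1) * ((k + 1) + r - 2) * ((k + 1) * r + r ^ 2 - r - 2) * b₁ * b₂ ^ 3 * β ^ 2 + 2 * ((k + 1) + r) * (r + 1) * (r + 2) * ((k + 1) + r - 2) * ((k + 1) + r - 1) * b₁ * b₂ ^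 2 * β ^ 3 - 2 * ((k + 1) + r) * (r + 2) ^ 2 * ((k + 1) + r - 2) * ((k + 1) + r - 1) * ((k + 1) + r + 1) * b₁ * b₂ * β ^ 4 + (r + 1) * (r + 2) * ((k + 1) + r - 2) * ((k + 1) + r - 1) * b₂ ^ 4 * β ^ 2 - 2 * ((k + 1) + r) * (r + 1) * (r + 2) * ((k + 1) + r - 2) * ((k + 1) + r - 1) * b₂ ^ 3 * β ^ 3 + ((k + 1) + r) * (r + 2) ^ 2 * ((k + 1) + r - 2) * ((k + 1) + r - 1) * ((k + 1) + r + 1) * b₂ ^ 2 * β ^ 4) := by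
  grind

set_option maxHeartbeats 4000000 in -- seven stages of `field_simp`/`ring` bookkeeping
set_option maxRecDepth 8000 in
/-- **CONJECTURE R at the vertex (1,1,0).**  The operator Hurwitz matrix (doubled kernel: rows
`2k ↦ W(k,·)`, `2k+1 ↦ C(k,·)`, `C(k,l) = W(k+1,l) - W(k,l-1)`) of
`W = (Θ_{b₁} + r)(Θ_{b₂} + r + 1)(βD + 1)` — bands `κ₀(k) = (k+r)(k+r+1)`,
`κ₁(k) = k(k+r)(b₁+b₂+β(k+r+1))`, `κ₂(k) = k(k-1)(b₁b₂ + β(b₁+b₂)(k+r))`, `κ₃(k) = b₁b₂βk(k-1)(k-2)` — is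
totally nonnegative for `b₁, b₂, β, r > 0` (no condition `b₁ ≠ b₂` is needed).  Proof: the seven-stage
elimination `R = E₁⋯E₇·U` of the proof note (multipliers `k/3`, `9b₁b₂β/G₃`, `kG₃²/(3G₆(k-1))`,
`G₆(k-1)G₆(k)/(G₃G₈(k))`, `a₂₁/b₂₀`, `b₂₀/a₃₀`, `a₃₀/(2(k+r))`, boundary `μ₄(0) = 0`), `U` the staircase
`(r(r+1)·e₀ | 2(k+r+1)·e_{k+1})`. -/
theorem twoNeutralClassical_hurwitz_tn (b₁ b₂ β r : ℝ) (hb₁ : 0 < b₁) (hb₂ : 0 < b₂) (hβ : 0 < β) (hr : 0 < r) (κ₀ κ₁ κ₂ κ₃ : ℕ → ℝ)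
    (hκ₀ : ∀ k : ℕ, κ₀ k = ((k : ℝ) + r) * ((k : ℝ) + r + 1))
    (hκ₁ : ∀ k : ℕ, κ₁ k = (k : ℝ) * ((k : ℝ) + r) * (b₁ + b₂ + β * ((k : ℝ) + r + 1)))
    (hκ₂ : ∀ k : ℕ, κ₂ k = (k : ℝ) * ((k : ℝ) - 1) * (b₁ * b₂ + β * (b₁ + b₂) * ((k : ℝ) + r)))
    (hκ₃ : ∀ k : ℕ, κ₃ k = b₁ * b₂ * β * ((k : ℝ) * ((k : ℝ) - 1) * ((k : ℝ) - 2)))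
    {m : ℕ} (ρ γ : Fin m → ℕ) (hρ : StrictMono ρ) (hγ : StrictMono γ) :
    0 ≤ (Matrix.of fun i j =>
      if ρ i % 2 = 0 then
        (if γ j = ρ i / 2 then κ₀ (ρ i / 2) else if γ j + 1 = ρ i / 2 then κ₁ (ρ i / 2)
          else if γ j + 2 = ρ i / 2 then κ₂ (ρ i / 2)
          else if γ j + 3 = ρ i / 2 then κ₃ (ρ i / 2) else 0)
      else
        (if γ j = ρ i / 2 + 1 then κ₀ (ρ i / 2 + 1) - κ₀ (ρ i / 2)
          else if γ j = ρ i / 2 then κ₁ (ρ i / 2 + 1) - κ₁ (ρ i / 2)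
          else if γ j + 1 = ρ i / 2 then κ₂ (ρ i / 2 + 1) - κ₂ (ρ i / 2)
          else if γ j + 2 = ρ i / 2 then κ₃ (ρ i / 2 + 1) - κ₃ (ρ i / 2) else 0)).det := by
  -- one elimination stage on the doubled index (cf. `HurwitzPair.interleave_step` / `step_tn`)
  have stage : ∀ (X Y X' Y' : ℕ → ℕ → ℝ) (eE eO : ℕ → ℝ),
      (∀ l, X 0 l = X' 0 l) → (∀ k l, X (k + 1) l = X' (k + 1) l + eE (k + 1) * Y' k l) →
      (∀ k l, Y k l = Y' k l + eO k * X' k l) → eE 0 = 0 → (∀ k, 0 ≤ eE k) → (∀ k, 0 ≤ eO k) →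
      (∀ (n : ℕ) (ρ' γ' : Fin n → ℕ), StrictMono ρ' → StrictMono γ' →
        0 ≤ (Matrix.of fun i j =>
          (if ρ' i % 2 = 0 then X' (ρ' i / 2) (γ' j) else Y' (ρ' i / 2) (γ' j))).det) →
      ∀ (n : ℕ) (ρ' γ' : Fin n → ℕ), StrictMono ρ' → StrictMono γ' →
        0 ≤ (Matrix.of fun i j =>
          (if ρ' i % 2 = 0 then X (ρ' i / 2) (γ' j) else Y (ρ' i / 2) (γ' j))).det := by
    intro X Y X' Y' eE eO h0 hE hO he0 heE heO hTN n ρ' γ' hρ' hγ'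
    let R' : ℕ → ℕ → ℝ := fun t l => if t % 2 = 0 then X' (t / 2) l else Y' (t / 2) l
    let e : ℕ → ℝ := fun t => if t % 2 = 0 then eE (t / 2) else eO (t / 2)
    have heq : (Matrix.of fun i j =>
          (if ρ' i % 2 = 0 then X (ρ' i / 2) (γ' j) else Y (ρ' i / 2) (γ' j))) =
        Matrix.of fun i j => R' (ρ' i) (γ' j) + e (ρ' i) * R' (ρ' i - 1) (γ' j) := by
      ext i j
      simp only [R', e, Matrix.of_apply]
      rcases Nat.even_or_odd' (ρ' i) with ⟨k, hk | hk⟩ <;> rw [hk]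
      · have h1 : (2 * k) % 2 = 0 := by omega
        rw [if_pos h1, if_pos h1, if_pos h1, show (2 * k) / 2 = k by omega]
        rcases k with _ | k
        · rw [he0, zero_mul, add_zero]; exact h0 _
        · rw [if_neg (by omega), show (2 * (k + 1) - 1) / 2 = k by omega]; exact hE k _
      · rw [if_neg (by omega), if_neg (by omega), if_neg (by omega), if_pos (by omega),
          show (2 * k + 1) / 2 = k by omega, show (2 * k + 1 - 1) / 2 = k by omega]
        exact hO k _
    rw [heq]
    refine HurwitzPair.step_tn R' e (fun t => ?_) ?_ (fun n' ρ'' γ'' h1 h2 => hTN n' ρ'' γ'' h1 h2) ρ' γ' hρ' hγ'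
    · show 0 ≤ (if t % 2 = 0 then eE (t / 2) else eO (t / 2)); split_ifs; exacts [heE _, heO _]
    · show (if 0 % 2 = 0 then eE (0 / 2) else eO (0 / 2)) = 0; rw [if_pos rfl]; exact he0
  have hK1 : 0 < (b₁ * b₂ + β * (r + 2) * (b₁ + b₂)) := by positivity
  have hK1ne : (b₁ * b₂ + β * (r + 2) * (b₁ + b₂)) ≠ 0 := hK1.ne'
  let G5f : ℕ → ℝ := fun k => (2 * (k : ℝ) + r + 1) * b₁ ^ 2 * b₂ + (r + 2) * (2 * (k : ℝ) + r + 1) * b₁ ^ 2 * β + (2 * (k : ℝ) + r + 1) * b₁ * b₂ ^ 2 - 2 * (r - 1) * (2 * (k : ℝ) + 3 * r + 3) * b₁ * b₂ * β + (r + 2) * ((k : ℝ) + r + 1) * (3 * (k : ℝ) + r + 2) * b₁ * β ^ 2 + (r + 2) * (2 * (k : ℝ) + r + 1) * b₂ ^ 2 * β + (r + 2) * ((k : ℝ) + r + 1) * (3 * (k : ℝ) + r + 2) * b₂ * β ^ 2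
  let G6f : ℕ → ℝ := fun k => 2 * b₁ ^ 2 * b₂ ^ 2 - 2 * (r - 1) * b₁ ^ 2 * b₂ * β + (r + 2) * (3 * (k : ℝ) + 2 * r + 1) * b₁ ^ 2 * β ^ 2 - 2 * (r - 1) * b₁ * b₂ ^ 2 * β - 2 * (r - 1) * (r + 2) * b₁ * b₂ * β ^ 2 + (r + 2) * (3 * (k : ℝ) + 2 * r + 1) * b₂ ^ 2 * β ^ 2
  let G7f : ℕ → ℝ := fun k => 2 * (r + 1) * b₁ ^ 2 * b₂ ^ 2 - 2 * (r + 1) * ((k : ℝ) + r - 1) * b₁ ^ 2 * b₂ * β + (r + 2) * ((k : ℝ) + r - 1) * ((k : ℝ) + 2 * r + 2) * b₁ ^ 2 * β ^ 2 - 2 * (r + 1) * ((k : ℝ) + r - 1) * b₁ * b₂ ^ 2 * β - 2 * (r + 1) * (r + 2) * ((k : ℝ) + r - 1) * b₁ * b₂ * β ^ 2 + (r + 2) * ((k : ℝ) + r - 1) * ((k : ℝ) + 2 * r + 2) * b₂ ^ 2 * β ^ 2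
  let G8f : ℕ → ℝ := fun k => (r + 1) * b₁ ^ 3 * b₂ ^ 2 - 2 * (r + 1) * ((k : ℝ) + r - 1) * b₁ ^ 3 * b₂ * β + ((k : ℝ) + r) * (r + 2) * ((k : ℝ) + r - 1) * b₁ ^ 3 * β ^ 2 + (r + 1) * b₁ ^ 2 * b₂ ^ 3 + 2 * (r + 1) * b₁ ^ 2 * b₂ ^ 2 * β + ((k : ℝ) + r) * (r + 2) ^ 2 * ((k : ℝ) + r - 1) * b₁ ^ 2 * β ^ 3 - 2 * (r + 1) * ((k : ℝ) + r - 1) * b₁ * b₂ ^ 3 * β - 2 * ((k : ℝ) + r) * (r + 2) ^ 2 * ((k : ℝ) + r - 1) * b₁ * b₂ * β ^ 3 + ((k : ℝ) + r) * (r + 2) * ((k : ℝ) + r - 1) * b₂ ^ 3 * β ^ 2 + ((k : ℝ) + r) * (r + 2) ^ 2 * ((k : ℝ) + r - 1) * b₂ ^ 2 * β ^ 3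
  let G9f : ℕ → ℝ := fun k => (r + 1) * (2 * (k : ℝ) + r + 1) * b₁ ^ 4 * b₂ ^ 2 - 2 * (r + 1) * ((k : ℝ) + r - 1) * (2 * (k : ℝ) + r + 1) * b₁ ^ 4 * b₂ * β + ((k : ℝ) + r) * (r + 2) * ((k : ℝ) + r - 1) * (2 * (k : ℝ) + r + 1) * b₁ ^ 4 * β ^ 2 - 2 * (r - 1) * (r + 1) * b₁ ^ 3 * b₂ ^ 3 + 2 * (r + 1) * ((k : ℝ) * r + (k : ℝ) + r ^ 2 - 2 * r + 3) * b₁ ^ 3 * b₂ ^ 2 * β + 2 * (r + 1) * ((k : ℝ) + r - 1) * ((k : ℝ) * r - 4 * (k : ℝ) + r ^ 2 - 2 * r - 2) * b₁ ^ 3 * b₂ * β ^ 2 - 2 * ((k : ℝ) + r) * (r - 1) * (r + 2) * ((k : ℝ) + r - 1) * ((k : ℝ) + r + 1) * b₁ ^ 3 * β ^ 3 + (r + 1) * (2 * (k : ℝ) + r + 1) * b₁ ^ 2 * b₂ ^ 4 + 2 * (r + 1) * ((k : ℝ) * r + (k : ℝ) + r ^ 2 - 2 * r + 3) * b₁ ^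 2 * b₂ ^ 3 * β - 2 * (r + 1) * (3 * (k : ℝ) ^ 2 * r - 6 * (k : ℝ) ^ 2 + 6 * (k : ℝ) * r ^ 2 - 13 * (k : ℝ) * r - 2 * (k : ℝ) + 3 * r ^ 3 - 7 * r ^ 2 - 2) * b₁ ^ 2 * b₂ ^ 2 * β ^ 2 + 2 * ((k : ℝ) + r) * (r - 1) * (r + 2) * ((k : ℝ) + r - 1) * ((k : ℝ) + r + 1) * b₁ ^ 2 * b₂ * β ^ 3 + ((k : ℝ) + r) * (r + 2) ^ 2 * ((k : ℝ) + r - 1) * ((k : ℝ) + r + 1) * (3 * (k : ℝ) + r + 2) * b₁ ^ 2 * β ^ 4 - 2 * (r + 1) * ((k : ℝ) + r - 1) * (2 * (k : ℝ) + r + 1) * b₁ * b₂ ^ 4 * β + 2 * (r + 1) * ((k : ℝ) + r - 1) * ((k : ℝ) * r - 4 * (k : ℝ) + r ^ 2 - 2 * r - 2) * b₁ * b₂ ^ 3 * β ^ 2 + 2 * ((k : ℝ) + r) * (r - 1) * (r + 2) * ((k : ℝ) + r - 1) * ((k : ℝ) + r + 1) * b₁ * b₂ ^ 2 * β ^ 3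 - 2 * ((k : ℝ) + r) * (r + 2) ^ 2 * ((k : ℝ) + r - 1) * ((k : ℝ) + r + 1) * (3 * (k : ℝ) + r + 2) * b₁ * b₂ * β ^ 4 + ((k : ℝ) + r) * (r + 2) * ((k : ℝ) + r - 1) * (2 * (k : ℝ) + r + 1) * b₂ ^ 4 * β ^ 2 - 2 * ((k : ℝ) + r) * (r - 1) * (r + 2) * ((k : ℝ) + r - 1) * ((k : ℝ) + r + 1) * b₂ ^ 3 * β ^ 3 + ((k : ℝ) + r) * (r + 2) ^ 2 * ((k : ℝ) + r - 1) * ((k : ℝ) + r + 1) * (3 * (k : ℝ) + r + 2) * b₂ ^ 2 * β ^ 4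
  let G10f : ℕ → ℝ := fun k => (r + 1) ^ 2 * b₁ ^ 4 * b₂ ^ 2 - 2 * (r + 1) ^ 2 * ((k : ℝ) + r - 2) * b₁ ^ 4 * b₂ * β + (r + 1) * (r + 2) * ((k : ℝ) + r - 2) * ((k : ℝ) + r - 1) * b₁ ^ 4 * β ^ 2 - 2 * (r + 1) ^ 2 * b₁ ^ 3 * b₂ ^ 3 + 2 * (r + 1) ^ 2 * ((k : ℝ) + r - 2) * b₁ ^ 3 * b₂ ^ 2 * β + 2 * (r + 1) * ((k : ℝ) + r - 2) * ((k : ℝ) * r + r ^ 2 - r - 2) * b₁ ^ 3 * b₂ * β ^ 2 - 2 * ((k : ℝ) + r) * (r + 1) * (r + 2) * ((k : ℝ) + r - 2) * ((k : ℝ) + r - 1) * b₁ ^ 3 * β ^ 3 + (r + 1) ^ 2 * b₁ ^ 2 * b₂ ^ 4 + 2 * (r + 1) ^ 2 * ((k : ℝ) + r - 2) * b₁ ^ 2 * b₂ ^ 3 * β - 2 * (r + 1) * (3 * (k : ℝ) ^ 2 * r + 2 * (k : ℝ) ^ 2 + 6 * (k : ℝ) * r ^ 2 - 5 * (k : ℝ)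 * r - 10 * (k : ℝ) + 3 * r ^ 3 - 7 * r ^ 2 - 4 * r + 6) * b₁ ^ 2 * b₂ ^ 2 * β ^ 2 + 2 * ((k : ℝ) + r) * (r + 1) * (r + 2) * ((k : ℝ) + r - 2) * ((k : ℝ) + r - 1) * b₁ ^ 2 * b₂ * β ^ 3 + ((k : ℝ) + r) * (r + 2) ^ 2 * ((k : ℝ) + r - 2) * ((k : ℝ) + r - 1) * ((k : ℝ) + r + 1) * b₁ ^ 2 * β ^ 4 - 2 * (r + 1) ^ 2 * ((k : ℝ) + r - 2) * b₁ * b₂ ^ 4 * β + 2 * (r + 1) * ((k : ℝ) + r - 2) * ((k : ℝ) * r + r ^ 2 - r - 2) * b₁ * b₂ ^ 3 * β ^ 2 + 2 * ((k : ℝ) + r) * (r + 1) * (r + 2) * ((k : ℝ) + r - 2) * ((k : ℝ) + r - 1) * b₁ * b₂ ^ 2 * β ^ 3 - 2 * ((k : ℝ) + r) * (r + 2) ^ 2 * ((k : ℝ) + r - 2) * ((k : ℝ) + r - 1) * ((k : ℝ) + r + 1) * b₁ * b₂ * β ^ 4 + (r + 1) * (r + 2) * ((k : ℝ) + r - 2)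 * ((k : ℝ) + r - 1) * b₂ ^ 4 * β ^ 2 - 2 * ((k : ℝ) + r) * (r + 1) * (r + 2) * ((k : ℝ) + r - 2) * ((k : ℝ) + r - 1) * b₂ ^ 3 * β ^ 3 + ((k : ℝ) + r) * (r + 2) ^ 2 * ((k : ℝ) + r - 2) * ((k : ℝ) + r - 1) * ((k : ℝ) + r + 1) * b₂ ^ 2 * β ^ 4
  have hG5f : ∀ k : ℕ, G5f k = (2 * (k : ℝ) + r + 1) * b₁ ^ 2 * b₂ + (r + 2) * (2 * (k : ℝ) + r + 1) * b₁ ^ 2 * β + (2 * (k : ℝ) + r + 1) * b₁ * b₂ ^ 2 - 2 * (r - 1) * (2 * (k : ℝ) + 3 * r + 3) * b₁ * b₂ * β + (r + 2) * ((k : ℝ) + r + 1) * (3 * (k : ℝ) + r + 2) * b₁ * β ^ 2 + (r + 2) * (2 * (k : ℝ) + r + 1) * b₂ ^ 2 * β + (r + 2) * ((k : ℝ) + r + 1) * (3 * (k : ℝ) + r + 2) * b₂ * β ^ 2 := fun k => rfl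
  have hG6f : ∀ k : ℕ, G6f k = 2 * b₁ ^ 2 * b₂ ^ 2 - 2 * (r - 1) * b₁ ^ 2 * b₂ * β + (r + 2) * (3 * (k : ℝ) + 2 * r + 1) * b₁ ^ 2 * β ^ 2 - 2 * (r - 1) * b₁ * b₂ ^ 2 * β - 2 * (r - 1) * (r + 2) * b₁ * b₂ * β ^ 2 + (r + 2) * (3 * (k : ℝ) + 2 * r + 1) * b₂ ^ 2 * β ^ 2 := fun k => rfl
  have hG7f : ∀ k : ℕ, G7f k = 2 * (r + 1) * b₁ ^ 2 * b₂ ^ 2 - 2 * (r + 1) * ((k : ℝ) + r - 1) * b₁ ^ 2 * b₂ * β + (r + 2) * ((k : ℝ) + r - 1) * ((k : ℝ) + 2 * r + 2) * b₁ ^ 2 * β ^ 2 - 2 * (r + 1) * ((k : ℝ) + r - 1) * b₁ * b₂ ^ 2 * β - 2 * (r + 1) * (r + 2) * ((k : ℝ) + r - 1) * b₁ * b₂ * β ^ 2 + (r + 2) * ((k : ℝ) + r - 1) * ((k : ℝ) + 2 * r + 2) * b₂ ^ 2 * β ^ 2 := fun k => rfl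
  have hG8f : ∀ k : ℕ, G8f k = (r + 1) * b₁ ^ 3 * b₂ ^ 2 - 2 * (r + 1) * ((k : ℝ) + r - 1) * b₁ ^ 3 * b₂ * β + ((k : ℝ) + r) * (r + 2) * ((k : ℝ) + r - 1) * b₁ ^ 3 * β ^ 2 + (r + 1) * b₁ ^ 2 * b₂ ^ 3 + 2 * (r + 1) * b₁ ^ 2 * b₂ ^ 2 * β + ((k : ℝ) + r) * (r + 2) ^ 2 * ((k : ℝ) + r - 1) * b₁ ^ 2 * β ^ 3 - 2 * (r + 1) * ((k : ℝ) + r - 1) * b₁ * b₂ ^ 3 * β - 2 * ((k : ℝ) + r) * (r + 2) ^ 2 * ((k : ℝ) + r - 1) * b₁ * b₂ * β ^ 3 + ((k : ℝ) + r) * (r + 2) * ((k : ℝ) + r - 1) * b₂ ^ 3 * β ^ 2 + ((k : ℝ) + r) * (r + 2) ^ 2 * ((k : ℝ) + r - 1) * b₂ ^ 2 * β ^ 3 := fun k => rfl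
  have hG9f : ∀ k : ℕ, G9f k = (r + 1) * (2 * (k : ℝ) + r + 1) * b₁ ^ 4 * b₂ ^ 2 - 2 * (r + 1) * ((k : ℝ) + r - 1) * (2 * (k : ℝ) + r + 1) * b₁ ^ 4 * b₂ * β + ((k : ℝ) + r) * (r + 2) * ((k : ℝ) + r - 1) * (2 * (k : ℝ) + r + 1) * b₁ ^ 4 * β ^ 2 - 2 * (r - 1) * (r + 1) * b₁ ^ 3 * b₂ ^ 3 + 2 * (r + 1) * ((k : ℝ) * r + (k : ℝ) + r ^ 2 - 2 * r + 3) * b₁ ^ 3 * b₂ ^ 2 * β + 2 * (r + 1) * ((k : ℝ) + r - 1) * ((k : ℝ) * r - 4 * (k : ℝ) + r ^ 2 - 2 * r - 2) * b₁ ^ 3 * b₂ * β ^ 2 - 2 * ((k : ℝ) + r) * (r - 1) * (r + 2) * ((k : ℝ) + r - 1) * ((k : ℝ) + r + 1) * b₁ ^ 3 * β ^ 3 + (r + 1) * (2 * (k : ℝ) + r + 1) * b₁ ^ 2 * b₂ ^ 4 + 2 * (r + 1) * ((k : ℝ) * r + (k : ℝ) + r ^ 2 - 2 * r + 3) * b₁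 ^ 2 * b₂ ^ 3 * β - 2 * (r + 1) * (3 * (k : ℝ) ^ 2 * r - 6 * (k : ℝ) ^ 2 + 6 * (k : ℝ) * r ^ 2 - 13 * (k : ℝ) * r - 2 * (k : ℝ) + 3 * r ^ 3 - 7 * r ^ 2 - 2) * b₁ ^ 2 * b₂ ^ 2 * β ^ 2 + 2 * ((k : ℝ) + r) * (r - 1) * (r + 2) * ((k : ℝ) + r - 1) * ((k : ℝ) + r + 1) * b₁ ^ 2 * b₂ * β ^ 3 + ((k : ℝ) + r) * (r + 2) ^ 2 * ((k : ℝ) + r - 1) * ((k : ℝ) + r + 1) * (3 * (k : ℝ) + r + 2) * b₁ ^ 2 * β ^ 4 - 2 * (r + 1) * ((k : ℝ) + r - 1) * (2 * (k : ℝ) + r + 1) * b₁ * b₂ ^ 4 * β + 2 * (r + 1) * ((k : ℝ) + r - 1) * ((k : ℝ) * r - 4 * (k : ℝ) + r ^ 2 - 2 * r - 2) * b₁ * b₂ ^ 3 * β ^ 2 + 2 * ((k : ℝ) + r) * (r - 1) * (r + 2) * ((k : ℝ) + r - 1) * ((k : ℝ) + r + 1) * b₁ * b₂ ^ 2 * β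 ^ 3 - 2 * ((k : ℝ) + r) * (r + 2) ^ 2 * ((k : ℝ) + r - 1) * ((k : ℝ) + r + 1) * (3 * (k : ℝ) + r + 2) * b₁ * b₂ * β ^ 4 + ((k : ℝ) + r) * (r + 2) * ((k : ℝ) + r - 1) * (2 * (k : ℝ) + r + 1) * b₂ ^ 4 * β ^ 2 - 2 * ((k : ℝ) + r) * (r - 1) * (r + 2) * ((k : ℝ) + r - 1) * ((k : ℝ) + r + 1) * b₂ ^ 3 * β ^ 3 + ((k : ℝ) + r) * (r + 2) ^ 2 * ((k : ℝ) + r - 1) * ((k : ℝ) + r + 1) * (3 * (k : ℝ) + r + 2) * b₂ ^ 2 * β ^ 4 := fun k => rfl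
  have hG10f : ∀ k : ℕ, G10f k = (r + 1) ^ 2 * b₁ ^ 4 * b₂ ^ 2 - 2 * (r + 1) ^ 2 * ((k : ℝ) + r - 2) * b₁ ^ 4 * b₂ * β + (r + 1) * (r + 2) * ((k : ℝ) + r - 2) * ((k : ℝ) + r - 1) * b₁ ^ 4 * β ^ 2 - 2 * (r + 1) ^ 2 * b₁ ^ 3 * b₂ ^ 3 + 2 * (r + 1) ^ 2 * ((k : ℝ) + r - 2) * b₁ ^ 3 * b₂ ^ 2 * β + 2 * (r + 1) * ((k : ℝ) + r - 2) * ((k : ℝ) * r + r ^ 2 - r - 2) * b₁ ^ 3 * b₂ * β ^ 2 - 2 * ((k : ℝ) + r) * (r + 1) * (r + 2) * ((k : ℝ) + r - 2) * ((k : ℝ) + r - 1) * b₁ ^ 3 * β ^ 3 + (r + 1) ^ 2 * b₁ ^ 2 * b₂ ^ 4 + 2 * (r + 1) ^ 2 * ((k : ℝ) + r - 2) * b₁ ^ 2 * b₂ ^ 3 * β - 2 * (r + 1) * (3 * (k : ℝ) ^ 2 * r + 2 * (k : ℝ) ^ 2 + 6 * (k : ℝ) * r ^ 2 - 5 * (k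 : ℝ) * r - 10 * (k : ℝ) + 3 * r ^ 3 - 7 * r ^ 2 - 4 * r + 6) * b₁ ^ 2 * b₂ ^ 2 * β ^ 2 + 2 * ((k : ℝ) + r) * (r + 1) * (r + 2) * ((k : ℝ) + r - 2) * ((k : ℝ) + r - 1) * b₁ ^ 2 * b₂ * β ^ 3 + ((k : ℝ) + r) * (r + 2) ^ 2 * ((k : ℝ) + r - 2) * ((k : ℝ) + r - 1) * ((k : ℝ) + r + 1) * b₁ ^ 2 * β ^ 4 - 2 * (r + 1) ^ 2 * ((k : ℝ) + r - 2) * b₁ * b₂ ^ 4 * β + 2 * (r + 1) * ((k : ℝ) + r - 2) * ((k : ℝ) * r + r ^ 2 - r - 2) * b₁ * b₂ ^ 3 * β ^ 2 + 2 * ((k : ℝ) + r) * (r + 1) * (r + 2) * ((k : ℝ) + r - 2) * ((k : ℝ) + r - 1) * b₁ * b₂ ^ 2 * β ^ 3 - 2 * ((k : ℝ) + r) * (r + 2) ^ 2 * ((k : ℝ) + r - 2) * ((k : ℝ) + r - 1) * ((k : ℝ) + r + 1) * b₁ * b₂ * β ^ 4 + (r + 1) * (r + 2) * ((k : ℝ)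 + r - 2) * ((k : ℝ) + r - 1) * b₂ ^ 4 * β ^ 2 - 2 * ((k : ℝ) + r) * (r + 1) * (r + 2) * ((k : ℝ) + r - 2) * ((k : ℝ) + r - 1) * b₂ ^ 3 * β ^ 3 + ((k : ℝ) + r) * (r + 2) ^ 2 * ((k : ℝ) + r - 2) * ((k : ℝ) + r - 1) * ((k : ℝ) + r + 1) * b₂ ^ 2 * β ^ 4 := fun k => rfl
  have hD2 : ∀ k : ℕ, 0 < G6f k := fun k => g6_pos b₁ b₂ β r k hb₂ hβ hr (Nat.cast_nonneg k)
  have hP36 : ∀ k : ℕ, 1 ≤ k → 0 < G8f k := fun k hk => g8_pos b₁ b₂ β r k hb₁ hb₂ hβ hr (by exact_mod_cast hk)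
  have hP105 : ∀ k : ℕ, 1 ≤ k → 0 < G9f k := by
    intro k hk
    rcases Nat.lt_or_ge k 2 with hlt | hge
    · obtain rfl : k = 1 := by omega
      exact g9_pos b₁ b₂ β r _ hb₁ hb₂ hβ hr (Or.inl (by norm_num))
    · exact g9_pos b₁ b₂ β r _ hb₁ hb₂ hβ hr (Or.inr (by exact_mod_cast hge))
  have hP69 : ∀ k : ℕ, 2 ≤ k → 0 < G10f k := fun k hk => g10_pos b₁ b₂ β r k hb₁ hb₂ hβ hr (by exact_mod_cast hk)
  have hGv : 0 < b₁ * b₂ * (b₁ + b₂) + β * (r + 2) * (b₁ ^ 2 + b₂ ^ 2) - 6 * (r + 1) * β * b₁ * b₂ + β ^ 2 * (r + 2) ^ 2 * (b₁ + b₂) := by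
    rw [show b₁ * b₂ * (b₁ + b₂) + β * (r + 2) * (b₁ ^ 2 + b₂ ^ 2) - 6 * (r + 1) * β * b₁ * b₂ + β ^ 2 * (r + 2) ^ 2 * (b₁ + b₂) = b₂ * (b₁ - (r + 2) * β) ^ 2 + b₁ * (b₂ - (r + 2) * β) ^ 2 + β * ((r + 2) * (b₁ - b₂) ^ 2 + 6 * b₁ * b₂) by ring]
    positivity
  have hF210 : 0 < G5f 0 := by
    have e : G5f 0 = (r + 1) * ((b₁ * b₂ * (b₁ + b₂) + β * (r + 2) * (b₁ ^ 2 + b₂ ^ 2) - 6 * (r + 1) * β * b₁ * b₂ + β ^ 2 * (r + 2) ^ 2 * (b₁ + b₂)) + 12 * β * b₁ * b₂) := by rw [hG5f]; push_cast; ring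
    rw [e]; positivity
  let a10 : ℕ → ℝ := fun k => ((k : ℝ) + r) * ((k : ℝ) + 3 * r + 3) / 3
  let a11 : ℕ → ℝ := fun k =>
    (k : ℝ) * ((b₁ + b₂) * ((k : ℝ) + 2 * r + 1) + 2 * β * ((k : ℝ) + r) * (r + 2)) / 3
  let a12 : ℕ → ℝ := fun k => (k : ℝ) * ((k : ℝ) - 1) * (b₁ * b₂ + β * (r + 2) * (b₁ + b₂)) / 3
  let μ2 : ℝ := 9 * b₁ * b₂ * β / (b₁ * b₂ + β * (r + 2) * (b₁ + b₂))
  let b10 : ℕ → ℝ := fun k => G5f k / (b₁ * b₂ + β * (r + 2) * (b₁ + b₂))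
  let b11 : ℕ → ℝ := fun k => (k : ℝ) * G6f k / (b₁ * b₂ + β * (r + 2) * (b₁ + b₂))
  let μ3 : ℕ → ℝ := fun k => if k = 0 then 0 else (k : ℝ) * (b₁ * b₂ + β * (r + 2) * (b₁ + b₂)) ^ 2 / (3 * G6f (k - 1))
  let a20 : ℕ → ℝ := fun k => if k = 0 then r * (r + 1) else ((k : ℝ) + r) * G7f k / G6f (k - 1)
  let a21 : ℕ → ℝ := fun k => if k = 0 then 0 else (k : ℝ) * G8f k / G6f (k - 1)
  let μ4 : ℕ → ℝ := fun k => if k = 0 then 0 else G6f (k - 1) * G6f k / ((b₁ * b₂ + β * (r + 2) * (b₁ + b₂)) * G8f k)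
  let b20 : ℕ → ℝ := fun k => if k = 0 then G5f 0 / (b₁ * b₂ + β * (r + 2) * (b₁ + b₂)) else b10 k - μ4 k * a20 k
  let μ5 : ℕ → ℝ := fun k => if k = 0 then 0 else a21 k / b20 (k - 1)
  let a30 : ℕ → ℝ := fun k => if k = 0 then r * (r + 1) else a20 k - μ5 k * (2 * ((k : ℝ) + r))
  let μ6 : ℕ → ℝ := fun k => b20 k / a30 k
  let μ7 : ℕ → ℝ := fun k => if k = 0 then 0 else a30 k / (2 * ((k : ℝ) + r))
  have hμ3S : ∀ k : ℕ, μ3 (k + 1) = ((k + 1 : ℕ) : ℝ) * (b₁ * b₂ + β * (r + 2) * (b₁ + b₂)) ^ 2 / (3 * G6f k) := fun k => by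
    show (if k + 1 = 0 then (0:ℝ) else _) = _; rw [if_neg (Nat.succ_ne_zero k), Nat.add_sub_cancel]
  have ha20S : ∀ k : ℕ, a20 (k + 1) = (((k + 1 : ℕ) : ℝ) + r) * G7f (k + 1) / G6f k := fun k => by
    show (if k + 1 = 0 then r * (r + 1) else _) = _; rw [if_neg (Nat.succ_ne_zero k), Nat.add_sub_cancel]
  have ha21S : ∀ k : ℕ, a21 (k + 1) = ((k + 1 : ℕ) : ℝ) * G8f (k + 1) / G6f k := fun k => by
    show (if k + 1 = 0 then (0:ℝ) else _) = _; rw [if_neg (Nat.succ_ne_zero k), Nat.add_sub_cancel]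
  have hμ4S : ∀ k : ℕ, μ4 (k + 1) = G6f k * G6f (k + 1) / ((b₁ * b₂ + β * (r + 2) * (b₁ + b₂)) * G8f (k + 1)) := fun k => by
    show (if k + 1 = 0 then (0:ℝ) else _) = _; rw [if_neg (Nat.succ_ne_zero k), Nat.add_sub_cancel]
  have hb20Z : b20 0 = G5f 0 / (b₁ * b₂ + β * (r + 2) * (b₁ + b₂)) := if_pos rfl
  have hb20S : ∀ k : ℕ, b20 (k + 1) = b10 (k + 1) - μ4 (k + 1) * a20 (k + 1) := fun k => if_neg (Nat.succ_ne_zero k)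
  have hμ5S : ∀ k : ℕ, μ5 (k + 1) = a21 (k + 1) / b20 k := fun k => by
    show (if k + 1 = 0 then (0:ℝ) else _) = _; rw [if_neg (Nat.succ_ne_zero k), Nat.add_sub_cancel]
  have ha30Z : a30 0 = r * (r + 1) := if_pos rfl
  have ha30S : ∀ k : ℕ, a30 (k + 1) = a20 (k + 1) - μ5 (k + 1) * (2 * (((k + 1 : ℕ) : ℝ) + r)) := fun k =>
    if_neg (Nat.succ_ne_zero k)
  have hμ7S : ∀ k : ℕ, μ7 (k + 1) = a30 (k + 1) / (2 * (((k + 1 : ℕ) : ℝ) + r)) := fun k => if_neg (Nat.succ_ne_zero k)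
  have hb20form : ∀ k : ℕ, b20 (k + 1) = (b₁ * b₂ + β * (r + 2) * (b₁ + b₂)) * G9f (k + 1) / ((b₁ * b₂ + β * (r + 2) * (b₁ + b₂)) * G8f (k + 1)) := by
    intro k; have hD := (hD2 k).ne'; have hP := (hP36 (k + 1) (by omega)).ne'
    rw [hb20S, eq_div_iff (mul_ne_zero hK1ne hP)]
    have e1 : (b10 (k + 1) - μ4 (k + 1) * a20 (k + 1)) * ((b₁ * b₂ + β * (r + 2) * (b₁ + b₂)) * G8f (k + 1))
        = G5f (k + 1) * G8f (k + 1) - (((k + 1 : ℕ) : ℝ) + r) * G6f (k + 1) * G7f (k + 1) := by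
      simp only [b10]; rw [hμ4S, ha20S]; field_simp
    rw [e1, hG5f, hG8f, hG6f, hG7f, hG9f]
    exact stage4_id b₁ b₂ β r ((k + 1 : ℕ) : ℝ)
  have hb20pos : ∀ k : ℕ, 0 < b20 k := fun k => by
    rcases k with _ | k
    · rw [hb20Z]; exact div_pos hF210 hK1
    · rw [hb20form k]; exact div_pos (mul_pos hK1 (hP105 _ (by omega))) (mul_pos hK1 (hP36 _ (by omega)))
  have ha30one : a30 1 = (((1 : ℕ) : ℝ) + r) * (r * (r + 1) * (b₁ * b₂ * (b₁ + b₂) + β * (r + 2) * (b₁ ^ 2 + b₂ ^ 2) - 6 * (r + 1) * β * b₁ * b₂ + β ^ 2 * (r + 2) ^ 2 * (b₁ + b₂)) * G6f 0) / (G6f 0 * G5f 0) := by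
    have hD := (hD2 0).ne'; have hF := hF210.ne'
    have u1 : a30 1 = a20 1 - μ5 1 * (2 * (((1 : ℕ) : ℝ) + r)) := if_neg one_ne_zero
    have u2 : μ5 1 = a21 1 / b20 0 := if_neg one_ne_zero
    have u3 : a20 1 = (((1 : ℕ) : ℝ) + r) * G7f 1 / G6f 0 := if_neg one_ne_zero
    have u4 : a21 1 = ((1 : ℕ) : ℝ) * G8f 1 / G6f 0 := if_neg one_ne_zero
    rw [u1, u2, u3, u4, hb20Z, eq_div_iff (mul_ne_zero hD hF)]
    have e1 : ((((1 : ℕ) : ℝ) + r) * G7f 1 / G6f 0 - ((1 : ℕ) : ℝ) * G8f 1 / G6f 0 / (G5f 0 / (b₁ * b₂ + β * (r + 2) * (b₁ + b₂))) * (2 * (((1 : ℕ) : ℝ) + r)))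
          * (G6f 0 * G5f 0) = (((1 : ℕ) : ℝ) + r) * (G7f 1 * G5f 0 - 2 * (b₁ * b₂ + β * (r + 2) * (b₁ + b₂)) * G8f 1) := by
      push_cast; field_simp
    rw [e1]
    congr 1
    rw [hG7f, hG5f, hG8f, hG6f]
    push_cast
    ring
  have ha30two : ∀ k : ℕ, a30 (k + 2) = (b₁ * b₂ + β * (r + 2) * (b₁ + b₂)) * ((((k + 2 : ℕ) : ℝ) + r) * ((((k + 1 : ℕ) : ℝ) + r) * G6f (k + 1) * G10f (k + 2)))
      / (G6f (k + 1) * ((b₁ * b₂ + β * (r + 2) * (b₁ + b₂)) * G9f (k + 1))) := by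
    intro k; have hD := (hD2 (k + 1)).ne'; have hP := (hP105 (k + 1) (by omega)).ne'
    have hP' := (hP36 (k + 1) (by omega)).ne'; have h21 : k + 2 - 1 = k + 1 := by omega
    have u1 : a30 (k + 2) = a20 (k + 2) - μ5 (k + 2) * (2 * (((k + 2 : ℕ) : ℝ) + r)) := if_neg (by omega)
    have u2 : μ5 (k + 2) = a21 (k + 2) / b20 (k + 1) := by
      show (if k + 2 = 0 then (0:ℝ) else a21 (k + 2) / b20 (k + 2 - 1)) = _; rw [if_neg (by omega), h21]
    have u3 : a20 (k + 2) = (((k + 2 : ℕ) : ℝ) + r) * G7f (k + 2) / G6f (k + 1) := by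
      show (if k + 2 = 0 then r * (r + 1) else (((k + 2 : ℕ) : ℝ) + r) * G7f (k + 2) / G6f (k + 2 - 1)) = _
      rw [if_neg (by omega), h21]
    have u4 : a21 (k + 2) = ((k + 2 : ℕ) : ℝ) * G8f (k + 2) / G6f (k + 1) := by
      show (if k + 2 = 0 then (0:ℝ) else ((k + 2 : ℕ) : ℝ) * G8f (k + 2) / G6f (k + 2 - 1)) = _; rw [if_neg (by omega), h21]
    rw [u1, u2, u3, u4, hb20form k, eq_div_iff (mul_ne_zero hD (mul_ne_zero hK1ne hP))]
    have e1 : ((((k + 2 : ℕ) : ℝ) + r) * G7f (k + 2) / G6f (k + 1) - ((k + 2 : ℕ) : ℝ) * G8f (k + 2) / G6f (k + 1)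
          / ((b₁ * b₂ + β * (r + 2) * (b₁ + b₂)) * G9f (k + 1) / ((b₁ * b₂ + β * (r + 2) * (b₁ + b₂)) * G8f (k + 1))) * (2 * (((k + 2 : ℕ) : ℝ) + r)))
          * (G6f (k + 1) * ((b₁ * b₂ + β * (r + 2) * (b₁ + b₂)) * G9f (k + 1)))
        = (b₁ * b₂ + β * (r + 2) * (b₁ + b₂)) * ((((k + 2 : ℕ) : ℝ) + r) * (G7f (k + 2) * G9f (k + 1)
          - 2 * ((k + 2 : ℕ) : ℝ) * G8f (k + 1) * G8f (k + 2))) := by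
      field_simp
    rw [e1]
    congr 1
    congr 1
    have hc : ((k + 2 : ℕ) : ℝ) = ((k + 1 : ℕ) : ℝ) + 1 := by push_cast; ring
    rw [hG7f, hG9f, hG8f, hG8f, hG6f, hG10f, hc]
    exact stage5_id b₁ b₂ β r ((k + 1 : ℕ) : ℝ)
  have ha30pos : ∀ k : ℕ, 0 < a30 k := fun k => by
    rcases k with _ | _ | k
    · rw [ha30Z]; positivity
    · show 0 < a30 1; rw [ha30one]
      exact div_pos (mul_pos (by positivity) (mul_pos (mul_pos (by positivity) hGv) (hD2 0))) (mul_pos (hD2 0) hF210)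
    · show 0 < a30 (k + 2); rw [ha30two k]
      exact div_pos (mul_pos hK1 (mul_pos (by positivity) (mul_pos (mul_pos (by positivity) (hD2 _)) (hP69 _ (by omega)))))
        (mul_pos (hD2 _) (mul_pos hK1 (hP105 _ (by omega))))
  have ha21nn : ∀ k : ℕ, 0 ≤ a21 k := fun k => by
    rcases k with _ | k
    · exact le_of_eq (if_pos rfl).symm
    · rw [ha21S]; exact div_nonneg (mul_nonneg (Nat.cast_nonneg _) (hP36 _ (by omega)).le) (hD2 k).le
  have hμ3nn : ∀ k : ℕ, 0 ≤ μ3 k := fun k => by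
    rcases k with _ | k
    · exact le_of_eq (if_pos rfl).symm
    · rw [hμ3S]; exact div_nonneg (by positivity) (mul_nonneg (by norm_num) (hD2 k).le)
  have hμ4nn : ∀ k : ℕ, 0 ≤ μ4 k := fun k => by
    rcases k with _ | k
    · exact le_of_eq (if_pos rfl).symm
    · rw [hμ4S]; exact div_nonneg (mul_nonneg (hD2 _).le (hD2 _).le) (mul_nonneg hK1.le (hP36 _ (by omega)).le)
  have hμ5nn : ∀ k : ℕ, 0 ≤ μ5 k := fun k => by
    rcases k with _ | k
    · exact le_of_eq (if_pos rfl).symm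
    · rw [hμ5S]; exact div_nonneg (ha21nn _) (hb20pos _).le
  have hμ6nn : ∀ k : ℕ, 0 ≤ μ6 k := fun k => div_nonneg (hb20pos k).le (ha30pos k).le
  have hμ7nn : ∀ k : ℕ, 0 ≤ μ7 k := fun k => by
    rcases k with _ | k
    · exact le_of_eq (if_pos rfl).symm
    · rw [hμ7S]; exact div_nonneg (ha30pos _).le (by positivity)
  let rowW : ℕ → ℕ → ℝ := fun k l =>
    if l = k then κ₀ k else if l + 1 = k then κ₁ k else if l + 2 = k then κ₂ k else if l + 3 = k then κ₃ k else 0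
  let rowC : ℕ → ℕ → ℝ := fun k l => if l = k + 1 then κ₀ (k + 1) - κ₀ k else if l = k then κ₁ (k + 1) - κ₁ k
      else if l + 1 = k then κ₂ (k + 1) - κ₂ k else if l + 2 = k then κ₃ (k + 1) - κ₃ k else 0
  let A1 : ℕ → ℕ → ℝ := fun k l => if l = k then a10 k else if l + 1 = k then a11 k else if l + 2 = k then a12 k else 0
  let B1 : ℕ → ℕ → ℝ := fun k l => if l = k + 1 then 2 * (((k + 1 : ℕ) : ℝ) + r) else if l = k then b10 k else if l + 1 = k then b11 k else 0
  let A2 : ℕ → ℕ → ℝ := fun k l => if l = k then a20 k else if l + 1 = k then a21 k else 0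
  let B2 : ℕ → ℕ → ℝ := fun k l => if l = k + 1 then 2 * (((k + 1 : ℕ) : ℝ) + r) else if l = k then b20 k else 0
  let A3 : ℕ → ℕ → ℝ := fun k l => if l = k then a30 k else 0
  let B3 : ℕ → ℕ → ℝ := fun k l => if l = k + 1 then 2 * (((k + 1 : ℕ) : ℝ) + r) else 0
  let A4 : ℕ → ℕ → ℝ := fun k l => if k = 0 ∧ l = 0 then r * (r + 1) else 0
  have I1Z : ∀ l, rowW 0 l = A1 0 l := by
    intro l; simp only [rowW, A1, a10, a11, a12, hκ₀, hκ₁, hκ₂, hκ₃]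
    split_ifs <;> first | (exfalso; omega) | ring1
  have I1S : ∀ k l, rowW (k + 1) l = A1 (k + 1) l + ((k + 1 : ℕ) : ℝ) / 3 * rowC k l := by
    intro k l; simp only [rowW, rowC, A1, a10, a11, a12, hκ₀, hκ₁, hκ₂, hκ₃]
    split_ifs <;> first | (exfalso; omega) | ring1 | (push_cast; ring1)
  have I2 : ∀ k l, rowC k l = B1 k l + μ2 * A1 k l := by
    intro k l; simp only [rowC, B1, A1, a10, a11, a12, b10, b11, μ2, hκ₀, hκ₁, hκ₂, hκ₃, hG5f, hG6f]
    split_ifs <;> first | (exfalso; omega) | ring1 | (push_cast; ring1) | (push_cast; field_simp; ring1)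
  have I3Z : ∀ l, A1 0 l = A2 0 l := by
    intro l; simp only [A1, A2, a10, a11, show a20 0 = r * (r + 1) from if_pos rfl, show a21 0 = (0:ℝ) from if_pos rfl]
    split_ifs <;> first | (exfalso; omega) | ring1
  have I3S : ∀ k l, A1 (k + 1) l = A2 (k + 1) l + μ3 (k + 1) * B1 k l := by
    intro k l; have hD := (hD2 k).ne'; rw [hμ3S]; simp only [A1, A2, B1, a10, a11, a12, b10, b11]
    split_ifs <;>
      first
        | (exfalso; omega)
        | (rw [ha20S]; field_simp; rw [hG6f, hG7f]; push_cast; ring1)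
        | (rw [ha21S]; field_simp; rw [hG6f, hG8f, hG5f]; push_cast; ring1)
        | ring1
        | (field_simp; push_cast; ring1)
  have I4 : ∀ k l, B1 k l = B2 k l + μ4 k * A2 k l := by
    intro k l
    rcases k with _ | k
    · simp only [B1, B2, A2, hb20Z, b10, show μ4 0 = 0 from if_pos rfl]
      split_ifs <;> first | (exfalso; omega) | ring1
    · have hD := (hD2 k).ne'; have hP := (hP36 (k + 1) (by omega)).ne'
      simp only [B1, B2, A2, hb20S, hμ4S, ha21S, b11]
      split_ifs <;> first | (exfalso; omega) | ring1 | (push_cast; field_simp; ring1)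
  have I5Z : ∀ l, A2 0 l = A3 0 l := by
    intro l; simp only [A2, A3, ha30Z, show a20 0 = r * (r + 1) from if_pos rfl, show a21 0 = (0:ℝ) from if_pos rfl]
    split_ifs <;> first | (exfalso; omega) | rfl
  have I5S : ∀ k l, A2 (k + 1) l = A3 (k + 1) l + μ5 (k + 1) * B2 k l := by
    intro k l; have hbk := (hb20pos k).ne'; simp only [A2, A3, B2, ha30S, hμ5S]
    split_ifs <;> first | (exfalso; omega) | ring1 | (rw [zero_add, div_mul_cancel₀ _ hbk])
  have I6 : ∀ k l, B2 k l = B3 k l + μ6 k * A3 k l := by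
    intro k l; have hak := (ha30pos k).ne'; simp only [B2, B3, A3, μ6]
    split_ifs <;> first | (exfalso; omega) | ring1 | (rw [zero_add, div_mul_cancel₀ _ hak])
  have I7Z : ∀ l, A3 0 l = A4 0 l := by
    intro l; simp only [A3, A4, ha30Z, true_and]
  have I7S : ∀ k l, A3 (k + 1) l = A4 (k + 1) l + μ7 (k + 1) * B3 k l := by
    intro k l
    have hden : (2 : ℝ) * (((k + 1 : ℕ) : ℝ) + r) ≠ 0 := by positivity
    simp only [A3, A4, B3, hμ7S, if_neg (show ¬ (k + 1 = 0 ∧ l = 0) by omega)]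
    split_ifs <;> first | ring1 | (rw [zero_add, div_mul_cancel₀ _ hden])
  have T7 : ∀ (n : ℕ) (ρ' γ' : Fin n → ℕ), StrictMono ρ' → StrictMono γ' →
      0 ≤ (Matrix.of fun i j =>
        (if ρ' i % 2 = 0 then A4 (ρ' i / 2) (γ' j) else B3 (ρ' i / 2) (γ' j))).det := by
    intro n ρ' γ' hρ' hγ'
    refine StairTN.stairs_minor_nonneg (fun t l => if t % 2 = 0 then A4 (t / 2) l else B3 (t / 2) l)
      (fun t => (t + 1) / 2) (fun t => (t + 1) / 2) (fun _ => le_rfl) (fun t => by omega)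
      ?_ ?_ ?_ ρ' γ' hρ' hγ'
    · intro t l
      show 0 ≤ (if t % 2 = 0 then A4 (t / 2) l else B3 (t / 2) l)
      by_cases h : t % 2 = 0
      · rw [if_pos h]; show 0 ≤ (if t / 2 = 0 ∧ l = 0 then r * (r + 1) else 0); split_ifs <;> positivity
      · rw [if_neg h]; show 0 ≤ (if l = t / 2 + 1 then 2 * ((((t / 2) + 1 : ℕ) : ℝ) + r) else 0); split_ifs <;> positivity
    all_goals intro t l hl; show (if t % 2 = 0 then A4 (t / 2) l else B3 (t / 2) l) = 0; by_cases h : t % 2 = 0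
    · rw [if_pos h]; exact if_neg (by omega)
    · rw [if_neg h]; exact if_neg (by omega)
    · rw [if_pos h]; exact if_neg (by omega)
    · rw [if_neg h]; exact if_neg (by omega)
  have T6 := stage A3 B3 A4 B3 μ7 (fun _ => 0) I7Z I7S (fun k l => by ring) (if_pos rfl) hμ7nn (fun _ => le_rfl) T7
  have T5 := stage A3 B2 A3 B3 (fun _ => 0) μ6 (fun l => rfl) (fun k l => by ring) I6 rfl (fun _ => le_rfl) hμ6nn T6
  have T4 := stage A2 B2 A3 B2 μ5 (fun _ => 0) I5Z I5S (fun k l => by ring) (if_pos rfl) hμ5nn (fun _ => le_rfl) T5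
  have T3 := stage A2 B1 A2 B2 (fun _ => 0) μ4 (fun l => rfl) (fun k l => by ring) I4 rfl (fun _ => le_rfl) hμ4nn T4
  have T2 := stage A1 B1 A2 B1 μ3 (fun _ => 0) I3Z I3S (fun k l => by ring) (if_pos rfl) hμ3nn (fun _ => le_rfl) T3
  have T1 := stage A1 rowC A1 B1 (fun _ => 0) (fun _ => μ2) (fun l => rfl) (fun k l => by ring) I2 rfl
    (fun _ => le_rfl) (fun _ => by positivity) T2
  have T0 := stage rowW rowC A1 rowC (fun k => ((k : ℕ) : ℝ) / 3) (fun _ => 0) I1Z I1S (fun k l => by ring) (by simp)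
    (fun _ => by positivity) (fun _ => le_rfl) T1
  exact T0 m ρ γ hρ hγ

end TwoNeutralClassical

end Summit.CriticalPhenomena.PercolationContinuityZ3.Theorems
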